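import Summits.CriticalPhenomena.SAWScalingLimit.Theses.SAWLoopLift

/-!
# Crux `GateFactorisation` (stmt-CriticalPhenomena-4849) — birth skeleton `Lines/birth.lean`

Route `route-CriticalPhenomena-SAWLoopLift`, sub-problem `SAWScalingLimit`.  The crux (continuum,
rank 5): for ANY measure `ν` on the Hausdorff hyperspace `NonemptyCompacts ℂ` carried by simple-loop
traces in `B(0,R)` with Werner's conformal-radius masses (constant `c > 0`), every Dobrushin domain
`(Ω; a, b) ⋐ B(0,R)`, every chordal SLE(8/3) law `μ` of `(Ω; a, b)` and every compact regular-closed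
`K ⊆ Ω`: the gate masses `ν(G_ε)` are eventually in `(0, ∞)` and
`ν(G_ε ∩ {T ∩ K = ∅}) / ν(G_ε) → μ{range γ ∩ K = ∅}` as `ε → 0⁺` (`G_ε` = traces in the window
crossing `∂Ω` only inside the `ε`-gates at `a`, `b`, meeting both gates, `Ω` and the outside).

## The line (the docstring's intended proof, cut at its two named seams)

"two-sided whole-plane SLE(8/3) + chordal restriction (complement of the outside arc ↓ Ω)" is a
statement AT POSITIVE GATE SCALE `ε`, whose honest output is an SLE(8/3) in `Ω` between the actual
crossing points `a_ε ∈ B(a,ε)`, `b_ε ∈ B(b,ε)` — not between `a` and `b`; the "pinning limit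
`ε → 0`" is continuity of chordal SLE(8/3) avoidance probabilities in the marked prime ends.  So:

* `stub_gateMass` — NON-DEGENERACY OF GATE MASSES: for a Werner-type `ν` and `(Ω;a,b) ⋐ B(0,R)`,
  eventually in `ε → 0⁺`, `0 < ν(G_ε) < ∞` (local finiteness of Werner's measure on loops of
  diameter `≥ |a-b| - 2ε` in a window — `G_ε` is Vietoris-open and its loops meet both gates — and
  full support on open sets of simple loops; needs the identification `ν = c·μ_Werner|window`
  (support item `WernerDetermination`, PROVED: `Theorems.WernerDetermination.wernerDetermination_proof`)
  together with a CONSTRUCTION of Werner's measure carrying these two properties; Werner 2008 §§2–3).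
* `stub_twoSidedGate` — TWO-SIDED RESTRICTION AT GATE SCALE (load-bearing): for every `η > 0` and
  all small `ε`, the `G_ε`-conditioned `ν`-probability that the trace misses `K` is within `η` of
  the SLE(8/3) avoidance probability `μ'{range ∩ K = ∅}` of `(Ω; a', b')` for SOME re-marking
  `D'` of the same Jordan domain with `|a'-a|, |b'-b| ≤ ε` and some SLE(8/3) law `μ'` of `D'`
  (Zhan 2021 Thm 1.1 + p. 25: Werner measure = SLE(8/3) loop measure, given one arc the other is
  chordal SLE(8/3) in the complement; LSW03 restriction, in tree as
  `IsSLELaw.hullRestriction_eightThirds_holds`, to descend to `Ω`; multi-crossing gate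
  configurations subdominant).  The `∃ D'` slack is exactly what the positive-`ε` argument yields.
* `stub_markContinuity` — PINNING LIMIT = MARKED-POINT CONTINUITY: for an SLE(8/3) law `μ` of
  `(Ω;a,b)` and compact regular-closed `K ⊆ Ω`, `μ'{range ∩ K = ∅} → μ{range ∩ K = ∅}` uniformly
  over SLE(8/3) laws `μ'` of re-markings `(Ω;a',b')` with `(a',b') → (a,b)` (conformal covariance
  under automorphisms of `Ω` tending to the identity on `closure Ω` — tree:
  `ChordalFamily.isRadoContinuous_of_forall_isSLELaw`, `IsSLELaw.conformalCovariance_holds` — plus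
  `{range ∩ K = ∅}` a `μ`-continuity set for regular-closed `K`; at `D' = D` it contains uniqueness
  of the SLE law's avoidance probabilities, `IsSLECurve.map_eq`).
* `stubComposition : StubComposition` — the kernel-checked composition `stub sigs → crux` (an
  `η/2 + η/2` argument along `𝓝[>] 0`, choosing `ε < min ε₀ θ`), and `GateFactorisation_of : GateFactorisation`
  — the crux BY NAME from the three stubs BY NAME (the registrar's skeleton theorem).

Disproof used: none on file for this crux (no `Cruxes/GateFactorisation/Disproof.lean` at
registration time, `ledger crux ls stmt-CriticalPhenomena-4849`: no workfiles).

Checks (registrar session planner-skel-stmt-CriticalPhenomena-4849-0, 2026-08-17): `lean check --json`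
rc 0, errors [], sorries 3 = the three `stub_*` (no `sorry` in `stubComposition`; `GateFactorisation_of`
only inherits the stubs'); BC3 probes
`stub → GateFactorisation` and `stub → SAWScalingLimit` for each stub by `exact?`, `simpa using h`,
`unfold; simpa using h`, `aesop` (with / without simp normalisation): 6 files × 6 tactics, all FAIL
(folder `bc/probe_<stub>_{crux,summit}.lean`).
-/

namespace Summit.CriticalPhenomena.SAWScalingLimit.Cruxes.GateFactorisation.Birth

open scoped Topology ENNReal NNReal
open Filter Set TopologicalSpace MeasureTheory

/-- STUB (gate masses, M): for a Werner-type measure `ν` on the window `B(0,R)` (simple-loop traces, conformal-radius masses with constant `c`) and a Dobrushin domain `(Ω; a, b) ⋐ B(0,R)`, the gate events `G_ε` have eventually (as `ε → 0⁺`) positive and finite `ν`-mass.  Local finiteness + full support of Werner's measure (Werner 2008 §§2–3) transported through `WernerDetermination`. [folklore-expected, not in tree] -/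
theorem stub_gateMass :
    letI : MeasurableSpace (TopologicalSpace.NonemptyCompacts ℂ) := borel (TopologicalSpace.NonemptyCompacts ℂ); ∀ (ν : MeasureTheory.Measure (TopologicalSpace.NonemptyCompacts ℂ)) (c R : ℝ), 0 < c → (∀ᵐ (T : TopologicalSpace.NonemptyCompacts ℂ) ∂ν, ∃ γ : Literature.Probability.RandomPlanarGeometry.CurveClass ℂ, γ ∈ (Literature.Probability.RandomPlanarGeometry.CurveClass.simpleLoop : Set (Literature.Probability.RandomPlanarGeometry.CurveClass ℂ)) ∧ γ.range = (T : Set ℂ)) → (∀ᵐ (T : TopologicalSpace.NonemptyCompacts ℂ) ∂ν, (T : Set ℂ) ⊆ Metric.ball (0 : ℂ) R) → (∀ (U V : Literature.Probability.RandomPlanarGeometry.JordanDomain) (z : ℂ) (φ : Literature.Probability.RandomPlanarGeometry.ConformalEquiv (Metric.ball (0 : ℂ) 1) U.carrier) (ψ : Literature.Probability.RandomPlanarGeometry.ConformalEquiv (Metric.ball (0 : ℂ) 1) V.carrier), U.carrier ⊆ Metric.ball (0 : ℂ) R → V.carrier ⊆ U.carrier → z ∈ V.carrier → φ 0 = z →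 ψ 0 = z → ν {T : TopologicalSpace.NonemptyCompacts ℂ | (T : Set ℂ) ⊆ U.carrier ∧ z ∉ (T : Set ℂ) ∧ Bornology.IsBounded (connectedComponentIn (T : Set ℂ)ᶜ z) ∧ ¬ (T : Set ℂ) ⊆ V.carrier} = ENNReal.ofReal (c * Real.log (‖deriv φ 0‖ / ‖deriv ψ 0‖))) → ∀ (D : Literature.Probability.RandomPlanarGeometry.DobrushinDomain), closure D.carrier ⊆ Metric.ball (0 : ℂ) R → let G : ℝ → Set ℂ → Prop := fun ε T => T ⊆ Metric.ball (0 : ℂ) R ∧ T ∩ (frontier D.carrier \ (Metric.ball (D.pt 0) ε ∪ Metric.ball (D.pt 1) ε)) = ∅ ∧ (T ∩ (D.carrier \ closure (Metric.ball (D.pt 0) ε ∪ Metric.ball (D.pt 1) ε))).Nonempty ∧ (T ∩ (closure D.carrier ∪ closure (Metric.ball (D.pt 0) ε ∪ Metric.ball (D.pt 1) ε))ᶜ).Nonempty ∧ (T ∩ Metric.ball (D.pt 0) ε).Nonempty ∧ (T ∩ Metric.ball (D.pt 1) ε).Nonempty; ∀ᶠ ε : ℝ in (nhdsWithin (0 :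 ℝ) (Set.Ioi 0)), 0 < ν {T : TopologicalSpace.NonemptyCompacts ℂ | G ε (T : Set ℂ)} ∧ ν {T : TopologicalSpace.NonemptyCompacts ℂ | G ε (T : Set ℂ)} < ⊤ := by
  sorry

/-- STUB (two-sided restriction at gate scale, L — load-bearing): for a Werner-type `ν`, `(Ω; a, b) ⋐ B(0,R)`, compact regular-closed `K ⊆ Ω` and `η > 0`: for all small gate widths `ε`, the `G_ε`-conditioned `ν`-probability of missing `K` is within `η` of the chordal SLE(8/3) avoidance probability of `K` in `(Ω; a', b')` for SOME re-marking of the same Jordan domain with `dist a' a ≤ ε`, `dist b' b ≤ ε` (Zhan 2021 Thm 1.1 + p. 25; LSW 2003 Thm 6.1 / `IsSLELaw.hullRestriction_eightThirds_holds`; multi-crossing configurations subdominant). Not in print. -/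
theorem stub_twoSidedGate :
    letI : MeasurableSpace (TopologicalSpace.NonemptyCompacts ℂ) := borel (TopologicalSpace.NonemptyCompacts ℂ); ∀ (ν : MeasureTheory.Measure (TopologicalSpace.NonemptyCompacts ℂ)) (c R : ℝ), 0 < c → (∀ᵐ (T : TopologicalSpace.NonemptyCompacts ℂ) ∂ν, ∃ γ : Literature.Probability.RandomPlanarGeometry.CurveClass ℂ, γ ∈ (Literature.Probability.RandomPlanarGeometry.CurveClass.simpleLoop : Set (Literature.Probability.RandomPlanarGeometry.CurveClass ℂ)) ∧ γ.range = (T : Set ℂ)) → (∀ᵐ (T : TopologicalSpace.NonemptyCompacts ℂ) ∂ν, (T : Set ℂ) ⊆ Metric.ball (0 : ℂ) R) → (∀ (U V : Literature.Probability.RandomPlanarGeometry.JordanDomain) (z : ℂ) (φ : Literature.Probability.RandomPlanarGeometry.ConformalEquiv (Metric.ball (0 : ℂ) 1) U.carrier) (ψ : Literature.Probability.RandomPlanarGeometry.ConformalEquiv (Metric.ball (0 : ℂ) 1) V.carrier), U.carrier ⊆ Metric.ball (0 : ℂ) R → V.carrier ⊆ U.carrier → z ∈ V.carrier → φ 0 =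 z → ψ 0 = z → ν {T : TopologicalSpace.NonemptyCompacts ℂ | (T : Set ℂ) ⊆ U.carrier ∧ z ∉ (T : Set ℂ) ∧ Bornology.IsBounded (connectedComponentIn (T : Set ℂ)ᶜ z) ∧ ¬ (T : Set ℂ) ⊆ V.carrier} = ENNReal.ofReal (c * Real.log (‖deriv φ 0‖ / ‖deriv ψ 0‖))) → ∀ (D : Literature.Probability.RandomPlanarGeometry.DobrushinDomain), closure D.carrier ⊆ Metric.ball (0 : ℂ) R → let G : ℝ → Set ℂ → Prop := fun ε T => T ⊆ Metric.ball (0 : ℂ) R ∧ T ∩ (frontier D.carrier \ (Metric.ball (D.pt 0) ε ∪ Metric.ball (D.pt 1) ε)) = ∅ ∧ (T ∩ (D.carrier \ closure (Metric.ball (D.pt 0) ε ∪ Metric.ball (D.pt 1) ε))).Nonempty ∧ (T ∩ (closure D.carrier ∪ closure (Metric.ball (D.pt 0) ε ∪ Metric.ball (D.pt 1) ε))ᶜ).Nonempty ∧ (T ∩ Metric.ball (D.pt 0) ε).Nonempty ∧ (T ∩ Metric.ball (D.pt 1) ε).Nonempty; ∀ (K : Set ℂ), IsCompact K → K ⊆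 D.carrier → closure (interior K) = K → ∀ η : ℝ, 0 < η → ∃ ε₀ : ℝ, 0 < ε₀ ∧ ∀ ε : ℝ, 0 < ε → ε < ε₀ → ∃ (D' : Literature.Probability.RandomPlanarGeometry.DobrushinDomain) (μ' : MeasureTheory.Measure (Literature.Probability.RandomPlanarGeometry.CurveClass ℂ)), D'.toJordanDomain = D.toJordanDomain ∧ dist (D'.pt 0) (D.pt 0) ≤ ε ∧ dist (D'.pt 1) (D.pt 1) ≤ ε ∧ Literature.Probability.RandomPlanarGeometry.IsSLELaw ((8 : NNReal) / 3) D' μ' ∧ |(ν {T : TopologicalSpace.NonemptyCompacts ℂ | G ε (T : Set ℂ) ∧ (T : Set ℂ) ∩ K = ∅}).toReal / (ν {T : TopologicalSpace.NonemptyCompacts ℂ | G ε (T : Set ℂ)}).toReal - (μ' {γ | γ.range ∩ K = ∅}).toReal| < η := by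
  sorry

/-- STUB (pinning limit = marked-point continuity, M): for a chordal SLE(8/3) law `μ` of `(Ω; a, b)` and a compact regular-closed `K ⊆ Ω`, the avoidance probability `μ'{range ∩ K = ∅}` of any SLE(8/3) law of a re-marking `(Ω; a', b')` of the same Jordan domain is within `η` of `μ{range ∩ K = ∅}` once `a', b'` are `θ`-close to `a, b` (conformal covariance under automorphisms of `Ω` → id on `closure Ω`, Radó continuity `ChordalFamily.isRadoContinuous_of_forall_isSLELaw`, and `{range ∩ K = ∅}` a `μ`-continuity set). -/
theorem stub_markContinuity :
    ∀ (D : Literature.Probability.RandomPlanarGeometry.DobrushinDomain) (μ : MeasureTheory.Measure (Literature.Probability.RandomPlanarGeometry.CurveClass ℂ)), Literature.Probability.RandomPlanarGeometry.IsSLELaw ((8 : NNReal) / 3) D μ → ∀ (K : Set ℂ), IsCompact K → K ⊆ D.carrier → closure (interior K) = K → ∀ η : ℝ, 0 < η → ∃ θ : ℝ, 0 < θ ∧ ∀ (D' : Literature.Probability.RandomPlanarGeometry.DobrushinDomain) (μ' : MeasureTheory.Measure (Literature.Probability.RandomPlanarGeometry.CurveClass ℂ)), D'.toJordanDomain = D.toJordanDomain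 → dist (D'.pt 0) (D.pt 0) < θ → dist (D'.pt 1) (D.pt 1) < θ → Literature.Probability.RandomPlanarGeometry.IsSLELaw ((8 : NNReal) / 3) D' μ' → |(μ' {γ | γ.range ∩ K = ∅}).toReal - (μ {γ | γ.range ∩ K = ∅}).toReal| < η := by
  sorry

/-- The COMPOSITION STATEMENT (arrow form): the three stub signatures, verbatim, imply the crux
`Summit.CriticalPhenomena.SAWScalingLimit.Theses.SAWLoopLift.GateFactorisation` BY NAME.  Wrapped in an
`abbrev` only so that the registrar (`#h21_check_skeleton`) sees exactly one theorem concluding the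
crux (`GateFactorisation_of` below, which feeds the stubs in by name). -/
abbrev StubComposition : Prop :=
    (letI : MeasurableSpace (TopologicalSpace.NonemptyCompacts ℂ) := borel (TopologicalSpace.NonemptyCompacts ℂ); ∀ (ν : MeasureTheory.Measure (TopologicalSpace.NonemptyCompacts ℂ)) (c R : ℝ), 0 < c → (∀ᵐ (T : TopologicalSpace.NonemptyCompacts ℂ) ∂ν, ∃ γ : Literature.Probability.RandomPlanarGeometry.CurveClass ℂ, γ ∈ (Literature.Probability.RandomPlanarGeometry.CurveClass.simpleLoop : Set (Literature.Probability.RandomPlanarGeometry.CurveClass ℂ)) ∧ γ.range = (T : Set ℂ)) → (∀ᵐ (T : TopologicalSpace.NonemptyCompacts ℂ) ∂ν, (T : Set ℂ) ⊆ Metric.ball (0 : ℂ) R) → (∀ (U V : Literature.Probability.RandomPlanarGeometry.JordanDomain) (z : ℂ) (φ : Literature.Probability.RandomPlanarGeometry.ConformalEquiv (Metric.ball (0 : ℂ) 1) U.carrier) (ψ : Literature.Probability.RandomPlanarGeometry.ConformalEquiv (Metric.ball (0 : ℂ) 1) V.carrier), U.carrier ⊆ Metric.ball (0 : ℂ) R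 → V.carrier ⊆ U.carrier → z ∈ V.carrier → φ 0 = z → ψ 0 = z → ν {T : TopologicalSpace.NonemptyCompacts ℂ | (T : Set ℂ) ⊆ U.carrier ∧ z ∉ (T : Set ℂ) ∧ Bornology.IsBounded (connectedComponentIn (T : Set ℂ)ᶜ z) ∧ ¬ (T : Set ℂ) ⊆ V.carrier} = ENNReal.ofReal (c * Real.log (‖deriv φ 0‖ / ‖deriv ψ 0‖))) → ∀ (D : Literature.Probability.RandomPlanarGeometry.DobrushinDomain), closure D.carrier ⊆ Metric.ball (0 : ℂ) R → let G : ℝ → Set ℂ → Prop := fun ε T => T ⊆ Metric.ball (0 : ℂ) R ∧ T ∩ (frontier D.carrier \ (Metric.ball (D.pt 0) ε ∪ Metric.ball (D.pt 1) ε)) = ∅ ∧ (T ∩ (D.carrier \ closure (Metric.ball (D.pt 0) ε ∪ Metric.ball (D.pt 1) ε))).Nonempty ∧ (T ∩ (closure D.carrier ∪ closure (Metric.ball (D.pt 0) ε ∪ Metric.ball (D.pt 1) ε))ᶜ).Nonempty ∧ (T ∩ Metric.ball (D.pt 0) ε).Nonempty ∧ (T ∩ Metric.ball (D.pt 1) ε).Nonempty;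 ∀ᶠ ε : ℝ in (nhdsWithin (0 : ℝ) (Set.Ioi 0)), 0 < ν {T : TopologicalSpace.NonemptyCompacts ℂ | G ε (T : Set ℂ)} ∧ ν {T : TopologicalSpace.NonemptyCompacts ℂ | G ε (T : Set ℂ)} < ⊤) →
    (letI : MeasurableSpace (TopologicalSpace.NonemptyCompacts ℂ) := borel (TopologicalSpace.NonemptyCompacts ℂ); ∀ (ν : MeasureTheory.Measure (TopologicalSpace.NonemptyCompacts ℂ)) (c R : ℝ), 0 < c → (∀ᵐ (T : TopologicalSpace.NonemptyCompacts ℂ) ∂ν, ∃ γ : Literature.Probability.RandomPlanarGeometry.CurveClass ℂ, γ ∈ (Literature.Probability.RandomPlanarGeometry.CurveClass.simpleLoop : Set (Literature.Probability.RandomPlanarGeometry.CurveClass ℂ)) ∧ γ.range = (T : Set ℂ)) → (∀ᵐ (T : TopologicalSpace.NonemptyCompacts ℂ) ∂ν, (T : Set ℂ) ⊆ Metric.ball (0 : ℂ) R) → (∀ (U V : Literature.Probability.RandomPlanarGeometry.JordanDomain) (z : ℂ) (φ : Literature.Probability.RandomPlanarGeometry.ConformalEquiv (Metric.ball (0 :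 ℂ) 1) U.carrier) (ψ : Literature.Probability.RandomPlanarGeometry.ConformalEquiv (Metric.ball (0 : ℂ) 1) V.carrier), U.carrier ⊆ Metric.ball (0 : ℂ) R → V.carrier ⊆ U.carrier → z ∈ V.carrier → φ 0 = z → ψ 0 = z → ν {T : TopologicalSpace.NonemptyCompacts ℂ | (T : Set ℂ) ⊆ U.carrier ∧ z ∉ (T : Set ℂ) ∧ Bornology.IsBounded (connectedComponentIn (T : Set ℂ)ᶜ z) ∧ ¬ (T : Set ℂ) ⊆ V.carrier} = ENNReal.ofReal (c * Real.log (‖deriv φ 0‖ / ‖deriv ψ 0‖))) → ∀ (D : Literature.Probability.RandomPlanarGeometry.DobrushinDomain), closure D.carrier ⊆ Metric.ball (0 : ℂ) R → let G : ℝ → Set ℂ → Prop := fun ε T => T ⊆ Metric.ball (0 : ℂ) R ∧ T ∩ (frontier D.carrier \ (Metric.ball (D.pt 0) ε ∪ Metric.ball (D.pt 1) ε)) = ∅ ∧ (T ∩ (D.carrier \ closure (Metric.ball (D.pt 0) ε ∪ Metric.ball (D.pt 1) ε))).Nonempty ∧ (T ∩ (closure D.carrier ∪ closure (Metric.ball (D.pt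 0) ε ∪ Metric.ball (D.pt 1) ε))ᶜ).Nonempty ∧ (T ∩ Metric.ball (D.pt 0) ε).Nonempty ∧ (T ∩ Metric.ball (D.pt 1) ε).Nonempty; ∀ (K : Set ℂ), IsCompact K → K ⊆ D.carrier → closure (interior K) = K → ∀ η : ℝ, 0 < η → ∃ ε₀ : ℝ, 0 < ε₀ ∧ ∀ ε : ℝ, 0 < ε → ε < ε₀ → ∃ (D' : Literature.Probability.RandomPlanarGeometry.DobrushinDomain) (μ' : MeasureTheory.Measure (Literature.Probability.RandomPlanarGeometry.CurveClass ℂ)), D'.toJordanDomain = D.toJordanDomain ∧ dist (D'.pt 0) (D.pt 0) ≤ ε ∧ dist (D'.pt 1) (D.pt 1) ≤ ε ∧ Literature.Probability.RandomPlanarGeometry.IsSLELaw ((8 : NNReal) / 3) D' μ' ∧ |(ν {T : TopologicalSpace.NonemptyCompacts ℂ | G ε (T : Set ℂ) ∧ (T : Set ℂ) ∩ K = ∅}).toReal / (ν {T : TopologicalSpace.NonemptyCompacts ℂ | G ε (T : Set ℂ)}).toReal - (μ' {γ | γ.range ∩ K = ∅}).toReal| < η) →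
    (∀ (D : Literature.Probability.RandomPlanarGeometry.DobrushinDomain) (μ : MeasureTheory.Measure (Literature.Probability.RandomPlanarGeometry.CurveClass ℂ)), Literature.Probability.RandomPlanarGeometry.IsSLELaw ((8 : NNReal) / 3) D μ → ∀ (K : Set ℂ), IsCompact K → K ⊆ D.carrier → closure (interior K) = K → ∀ η : ℝ, 0 < η → ∃ θ : ℝ, 0 < θ ∧ ∀ (D' : Literature.Probability.RandomPlanarGeometry.DobrushinDomain) (μ' : MeasureTheory.Measure (Literature.Probability.RandomPlanarGeometry.CurveClass ℂ)), D'.toJordanDomain = D.toJordanDomain → dist (D'.pt 0) (D.pt 0) < θ → dist (D'.pt 1) (D.pt 1) < θ → Literature.Probability.RandomPlanarGeometry.IsSLELaw ((8 : NNReal) / 3) D' μ' → |(μ' {γ | γ.range ∩ K = ∅}).toReal - (μ {γ | γ.range ∩ K = ∅}).toReal| < η) →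
    Summit.CriticalPhenomena.SAWScalingLimit.Theses.SAWLoopLift.GateFactorisation

/-- COMPOSITION (kernel-checked, no `sorry`): stub signatures → crux.  Proof: the first conjunct is
the gate-mass stub; for the `Tendsto`, given `η > 0` take `θ` from marked-point continuity (with
`η/2`) and `ε₀` from the two-sided gate stub (with `η/2`); for `0 < ε < min ε₀ θ` the re-marked SLE
law `μ'` is `η/2`-close to the gate ratio and (its marks being `ε < θ`-close) `η/2`-close to `μ`. -/
theorem stubComposition : StubComposition := by
  intro h0 h1 h2 ν c R hc hL hB hM D hDR μ hμ
  dsimp only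
  intro K hK hKD hKreg
  refine ⟨?_, ?_⟩
  · have h := h0 ν c R hc hL hB hM D hDR
    dsimp only at h
    exact h
  · rw [Metric.tendsto_nhds]
    intro η hη
    have hη2 : 0 < η / 2 := by positivity
    obtain ⟨θ, hθ, hcont⟩ := h2 D μ hμ K hK hKD hKreg (η / 2) hη2
    have h1' := h1 ν c R hc hL hB hM D hDR
    dsimp only at h1'
    obtain ⟨ε₀, hε₀, hsand⟩ := h1' K hK hKD hKreg (η / 2) hη2
    have hev2 : ∀ᶠ ε : ℝ in nhdsWithin (0 : ℝ) (Set.Ioi 0), ε ∈ Set.Ioi (0 : ℝ) :=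
      eventually_mem_nhdsWithin
    have hev3 : ∀ᶠ ε : ℝ in nhdsWithin (0 : ℝ) (Set.Ioi 0), ε ∈ Set.Iio (min ε₀ θ) :=
      mem_nhdsWithin_of_mem_nhds (Iio_mem_nhds (lt_min hε₀ hθ))
    filter_upwards [hev2, hev3] with ε hε hε'
    rw [Set.mem_Ioi] at hε
    rw [Set.mem_Iio] at hε'
    obtain ⟨D', μ', hJ, hd0, hd1, hμ', hclose⟩ :=
      hsand ε hε (lt_of_lt_of_le hε' (min_le_left _ _))
    have hεθ : ε < θ := lt_of_lt_of_le hε' (min_le_right _ _)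
    have hc' := hcont D' μ' hJ (lt_of_le_of_lt hd0 hεθ) (lt_of_le_of_lt hd1 hεθ) hμ'
    rw [Real.dist_eq]
    calc _ ≤ _ := abs_sub_le _ ((μ' {γ | γ.range ∩ K = ∅}).toReal) _
      _ < η / 2 + η / 2 := add_lt_add hclose hc'
      _ = η := by ring

/-- THE SKELETON THEOREM: the crux `Summit.CriticalPhenomena.SAWScalingLimit.Theses.SAWLoopLift.GateFactorisation`
BY NAME, from the three declared stubs BY NAME (no hypotheses; `sorry` only inside `stub_*`). -/
theorem GateFactorisation_of : Summit.CriticalPhenomena.SAWScalingLimit.Theses.SAWLoopLift.GateFactorisation :=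
  stubComposition stub_gateMass stub_twoSidedGate stub_markContinuity

end Summit.CriticalPhenomena.SAWScalingLimit.Cruxes.GateFactorisation.Birth
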